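import Summits.Parity.GeneralizedHardyLittlewood.Theorems.LeeYangFibresFibreHyperbolicityAlongNecessityAux
import Summits.Parity.GeneralizedHardyLittlewood.Theorems.LeeYangFibresFibreHyperbolicityAlongSiftedSinglesAlong
import Summits.Parity.GeneralizedHardyLittlewood.Theorems.LeeYangFibresAbsoluteUpgradeDipReduction
import HarnessLib

/-!
# Crux `FibreHyperbolicityAlong` (stmt-Parity-18103), line `sifted-chowla-distillation`:
# the NECESSITY theorem `stub_mixedPolyOfAlong` (helper file 2 of 2: the stub)

`FibreHyperbolicityAlong → CellParityLawSaving → ∀ m, …, |siftedLiouvilleCorr t N U Ψ K S| ≤ U^{-m} N U^t/(log N)^t`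
(`U = slowDegree N`, `S ≠ ∅`, singular mass `≥ ηN`): given the law, the crux clips every non-empty Walsh amplitude
below every power of `U`, hence every sifted Liouville correlation over the rough tuples has saving `U^{-m}` — the
open stub `SiftedChowlaMixedAlong` (saving `e^{-CU}`) is NECESSARY for the crux up to the shape of the saving.

Proof.  (1) θ-CLIPPING, verbatim the case B of the landed `quantClip_assembly` (crux `AbsoluteUpgrade`, line
`dip-margin-rate-exchange`) with the mass floor `ηN ≤ β_∞𝔖` as a hypothesis and the landed `marginPoly : MarginPoly`
at exponent `p = m + 4t`: `quantClip_thetaSmall` fed by `quantClip_scaleFacts` (anatomy `stub_anatomyAlong`),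
`MixedPoly.numericsP`, `quantClip_smallness` and the real-rootedness of every fibre gives
`|θ_S| ≤ 8^{t-1}(2^t + 1) U^{-p}` for `S ≠ ∅`.  (2) WALSH INVERSION, REVERSED (`MixedPoly.abs_sum_sign_cells_le`,
`MixedPoly.sum_sign_jointCell_eq_corr`): `|corr_S| ≤ U^t E₀ + β_∞𝔖 (|θ_S| Â^t + 2^{t+1} |Ã| Â^{t-1})`,
`E₀ = N/((log N)^t (log N)^δ)`, `Â = Σ_n A_n/N ≤ 2U²/log N` (anatomy), `|Ã| = |Σ_n (-1)^n A_n|/N ≤ e^{-(p+1)U} U/log N`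
(the landed `stub_siftedSinglesAlong` at `t = 1` for the identity form, `MixedPoly.altSum_cell_eq_corr`).
(3) SIZES along the schedule (`quantClip_massGrowth`: `β_∞𝔖 ≤ C_g N (log log N)^{t-1}`, `quantClip_schedule`:
`log log N ≤ (2U+2)²`, `e^{4U²} ≤ log N`, `quantClip_powSelf_le_exp`: `3U^m ≤ (log N)^δ`): `MixedPoly.final_bound`.
-/

noncomputable section

namespace Summit.Parity.GeneralizedHardyLittlewood.Cruxes.FibreHyperbolicityAlong.SiftedChowlaDistillation

open scoped BigOperators Classical
open Finset
open Literature.NumberTheory.Sieve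
open Summit.Parity.GeneralizedHardyLittlewood.Theses.LeeYangFibres (CellParityLawSaving)
open Summit.Parity.GeneralizedHardyLittlewood.Cruxes.AbsoluteUpgrade.DipMarginRateExchange (slowDegree
  four_le_slowDegree stub_anatomyAlong quantClip_schedule quantClip_massGrowth quantClip_powSelf_le_exp
  quantClip_scaleFacts quantClip_smallness quantClip_thetaSmall marginPoly)
open Summit.Parity.GeneralizedHardyLittlewood.Cruxes.ModelHyperbolicity.WindowChainTransport (cellDensity)
open Summit.Parity.GeneralizedHardyLittlewood.Cruxes.FibreHyperbolicity.ModelTransfer (jointCell fibre)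
open Summit.Parity.GeneralizedHardyLittlewood.Cruxes.AbsoluteUpgrade.NlcCellsAbsoluteClip (roughTuples walshForm)
open Summit.Parity.GeneralizedHardyLittlewood.Theorems.ModelHyperbolicity.Negative (cell cell_eq_zero_of_le)
open Summit.Parity.GeneralizedHardyLittlewood.Theorems.HyperbolicityClipsParity (sum_modelCells_le fibreSum_cast)

/-- **Stub `stub_mixedPolyOfAlong` (NECESSITY: crux + law ⟹ sifted `|S|`-point Chowla along the schedule with every
polynomial saving).**  For every `m, t ≥ 1, L, η > 0` and `N ≥ N₀`: if every fibre of the joint rough-cell polynomial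
along `U = slowDegree N` is real-rooted on bodies of singular mass `≥ ηN` (`FibreHyperbolicityAlong`) and the cells obey
the cell-parity law with a log-power saving (`CellParityLawSaving`), then for every admissible `(Ψ, K)` of singular
mass `≥ ηN` and every non-empty sign set `S`,
`|Σ_{n ∈ roughTuples Ψ K N U} ∏_{i∈S} λ(ψ_i(n))| ≤ U^{-m} · N U^t/(log N)^t`.  See the module docstring. -/
theorem stub_mixedPolyOfAlong : AbsoluteUpgrade.DipMarginRateExchange.FibreHyperbolicityAlong → CellParityLawSaving → ∀ (m t L : ℕ), 1 ≤ t → ∀ η : ℝ, 0 < η → ∃ N₀ : ℕ, ∀ N : ℕ, N₀ ≤ N → ∀ Ψ : Fin t → AffLinForm 1, IsNondegenerateSystem Ψ → affLinSize Ψ N ≤ L → ∀ K : Set (Fin 1 → ℝ), Convex ℝ K → K ⊆ realBox 1 N → η * (N : ℝ) ≤ archFactor Ψ K * singularProduct Ψ → ∀ S : Finset (Fin t), S.Nonempty → |(siftedLiouvilleCorr t N (slowDegree N) Ψ K S : ℝ)| ≤ ((slowDegree N : ℝ) ^ m)⁻¹ * N * (slowDegree N : ℝ) ^ t / Real.log N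 ^ t := by
  intro hF hLaw m t L ht η hη
  have hLaw' : AbsoluteUpgrade.DipMarginRateExchange.CellParityLawSaving := hLaw
  obtain ⟨δ, hδ, N_L, hL⟩ := hLaw' t L ht
  obtain ⟨N_H, hH⟩ := hF t L ht η hη
  obtain ⟨N_A, hNA⟩ := stub_anatomyAlong
  obtain ⟨C_g, hC_g, N_S, hNS⟩ := quantClip_massGrowth t L ht
  -- `t = s + 1`; the margin exponent `p = m + 4t`; singles at `C₁ = p + 1`
  obtain ⟨s, rfl⟩ : ∃ s, t = s + 1 := ⟨t - 1, by omega⟩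
  obtain ⟨p, hp⟩ : ∃ p : ℕ, p = m + 4 * (s + 1) := ⟨_, rfl⟩
  obtain ⟨u₀, hu₀⟩ := marginPoly p
  obtain ⟨N₁, hN₁⟩ := stub_siftedSinglesAlong 1 1 le_rfl ((p : ℝ) + 1)
  have h4δ : (0 : ℝ) < 4 * δ := by positivity
  obtain ⟨U₁, hU₁⟩ := quantClip_powSelf_le_exp h4δ (p + (s + 1) - 1) (2 ^ (s + 1 + 1) / η)
  obtain ⟨U₂, hU₂⟩ := quantClip_powSelf_le_exp h4δ m 3
  obtain ⟨K₂, hK₂⟩ : ∃ K₂ : ℝ, K₂ = 3 * (C_g * 4 ^ (2 * s) * 2 ^ (s + 1) * (8 ^ s * (2 ^ (s + 1) + 1))) := ⟨_, rfl⟩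
  obtain ⟨K₃, hK₃⟩ : ∃ K₃ : ℝ, K₃ = 3 * (C_g * 4 ^ (2 * s) * 2 ^ (s + 1 + 1) * 2 ^ s) := ⟨_, rfl⟩
  obtain ⟨N_Q, hNQ⟩ :=
    quantClip_schedule (max (L + 1) (max u₀ (max 16 (max (p + 4) (max U₁ (max U₂ (max ⌈K₂⌉₊ ⌈K₃⌉₊)))))))
  refine ⟨max N_L (max N_H (max N_A (max N_S (max N₁ N_Q)))), fun N hN Ψ hΨ hΨL K hK hKN hMS S hS => ?_⟩
  simp only [max_le_iff] at hN
  obtain ⟨hNL, hNH, hNA', hNS', hN1, hNQ'⟩ := hN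
  obtain ⟨hU₀U, hN16, hexpU, hll⟩ := hNQ N hNQ'
  simp only [max_le_iff] at hU₀U
  obtain ⟨hUL, hUu₀, hU16, hUp4, hUU₁, hUU₂, hUK₂, hUK₃⟩ := hU₀U
  -- everything at the scale `N`
  have hidL : affLinSize idForm N ≤ ((1 : ℕ) : ℝ) := by rw [(idForm_props (N : ℝ)).2.2]; simp
  have hcorr1 := hN₁ N hN1 idForm (idForm_props (N : ℝ)).1 hidL (realBox 1 N) (convex_Icc _ _) subset_rfl 0
  have hMSle := hNS N hNS' Ψ hΨ hΨL K hKN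
  have hAN := hNA N hNA'
  have hHN := hH N hNH Ψ hΨ hΨL K hK hKN hMS
  obtain ⟨θ, hθ0, hθ2, hcells⟩ := hL N hNL Ψ hΨ hΨL K hK hKN
  clear hN₁ hNS hNA hH hL hNQ
  set U : ℕ := slowDegree N with hUdef
  clear_value U
  -- positivity
  have hU1nat : 1 ≤ U := by omega
  have hU1 : (1 : ℝ) ≤ U := by exact_mod_cast hU1nat
  have hU0 : (0 : ℝ) < U := by linarith
  have hNnat : 1 ≤ N := by omega
  have hN0 : (0 : ℝ) < N := by exact_mod_cast (by omega : 0 < N)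
  have hlN : 0 < Real.log N := lt_of_lt_of_le (Real.exp_pos _) hexpU
  have hlNδ : 0 < Real.log N ^ δ := Real.rpow_pos_of_pos hlN δ
  have hMS0 : 0 < archFactor Ψ K * singularProduct Ψ := lt_of_lt_of_le (mul_pos hη hN0) hMS
  -- the sieving limit `N^{1/U} ≥ 4L + 5`
  have hz : (4 * L + 5 : ℝ) ≤ (N : ℝ) ^ ((1 : ℝ) / U) := by
    -- adapted from `stub_ghostFreeAlong`
    rw [Real.rpow_def_of_pos hN0, show Real.log N * (1 / U) = Real.log N / U by ring]
    have h2 : (4 * U : ℝ) ≤ Real.log N / U := by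
      rw [le_div_iff₀ hU0]; nlinarith [Real.add_one_le_exp (4 * (U : ℝ) ^ 2)]
    have h3 : (L : ℝ) + 1 ≤ U := by exact_mod_cast hUL
    linarith [Real.add_one_le_exp (Real.log N / U)]
  have hL0 : (0 : ℝ) ≤ L := Nat.cast_nonneg L
  have hz2 : (2 : ℝ) ≤ (N : ℝ) ^ ((1 : ℝ) / U) := by linarith
  have hzL : (2 * L : ℝ) ≤ (N : ℝ) ^ ((1 : ℝ) / U) := by linarith
  -- the normalised model cells `a_n = A_n(N)/N` and the anatomy, repackaged
  set a : ℕ → ℝ := fun n => (cell U N n : ℝ) / N with ha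
  have ha0 : ∀ n, 0 ≤ a n := fun n => by rw [ha]; positivity
  obtain ⟨hanat, hεa100, ha1pos, -, ha1ge, hI, hI0, hI1, hIbal⟩ :=
    quantClip_scaleFacts hU16 hN0 hlN (fun n => cell U N n) (cell_eq_zero_of_le hU1nat le_rfl) hAN
  have hasum : ∑ n ∈ Icc 1 U, a n ≤ 1 := by
    rw [ha, ← sum_div, div_le_one hN0]; exact sum_modelCells_le N U
  have hAp : ∑ n ∈ Icc 1 U, a n ≤ 2 * (U : ℝ) ^ 2 / Real.log N :=
    MixedPoly.sum_density_le hU1nat hlN (hεa100.trans (by norm_num)) a hanat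
  have hAp0 : 0 ≤ ∑ n ∈ Icc 1 U, a n := sum_nonneg fun n _ => ha0 n
  -- `|Ã| ≤ e^{-(p+1)U} U/log N` (singles at `t = 1` for the identity form)
  have hAm : |∑ n ∈ Icc 1 U, (-1 : ℝ) ^ n * a n| ≤ Real.exp (-(((p : ℝ) + 1) * U)) * U / Real.log N := by
    -- adapted from `stub_ghostFreeAlong`
    have hsum : ∑ n ∈ Icc 1 U, (-1 : ℝ) ^ n * a n = (siftedLiouvilleCorr 1 N U idForm (realBox 1 N) {0} : ℝ) / N := by
      rw [← MixedPoly.altSum_cell_eq_corr hNnat hU1nat hz2, sum_div]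
      exact sum_congr rfl fun n _ => by rw [ha]; ring
    rw [hsum, abs_div, abs_of_pos hN0, div_le_div_iff₀ hN0 hlN]
    rw [pow_one, pow_one, le_div_iff₀ hlN] at hcorr1
    linarith
  -- the law at `N`, on the box
  have hlaw : ∀ j ∈ Fintype.piFinset (fun _ : Fin (s + 1) => Icc 1 U),
      |(jointCell (s + 1) N U Ψ K j : ℝ) - walshForm θ j * (archFactor Ψ K * singularProduct Ψ * ∏ k, a (j k))| ≤
        N / (Real.log N ^ (s + 1) * Real.log N ^ δ) :=
    fun j hj => hcells j fun i => mem_Icc.mp (Fintype.mem_piFinset.mp hj i)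
  -- (1) θ-CLIPPING (case B of `quantClip_assembly` with `η₀ = η`, margin at exponent `p`)
  have hκδ : 2 ^ (s + 1 + 1) / η * (U : ℝ) ^ (U + (p + (s + 1) - 1)) ≤ Real.log N ^ δ := by
    have h1 := hU₁ U hUU₁
    have h2 : Real.exp (4 * δ * (U : ℝ) ^ 2) = (Real.exp (4 * (U : ℝ) ^ 2)) ^ δ := by
      rw [← Real.exp_mul]; ring_nf
    rw [h2] at h1
    exact h1.trans (Real.rpow_le_rpow (Real.exp_pos _).le hexpU hδ.le)
  have hDm : 3 * (U : ℝ) ^ m ≤ Real.log N ^ δ := by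
    have h1 := hU₂ U hUU₂
    have h2 : Real.exp (4 * δ * (U : ℝ) ^ 2) = (Real.exp (4 * (U : ℝ) ^ 2)) ^ δ := by
      rw [← Real.exp_mul]; ring_nf
    rw [h2] at h1
    have h3 : (U : ℝ) ^ m ≤ (U : ℝ) ^ (U + m) := pow_le_pow_right₀ hU1 (by omega)
    exact le_trans (by linarith) (h1.trans (Real.rpow_le_rpow (Real.exp_pos _).le hexpU hδ.le))
  obtain ⟨hν₁, hν₂, hr⟩ := MixedPoly.numericsP (Nat.le_add_left 1 s) hUp4 hη hlNδ hκδ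
  have hsmall := quantClip_smallness (δ := δ) (Nat.le_add_left 1 s) hU0.le hN0 hlN hη hMS ha1ge
  have hϑpos : 0 < ((U : ℝ) ^ p)⁻¹ := by positivity
  have hν₀0 : 0 ≤ 2 ^ (s + 1 - 1) * (U : ℝ) ^ (s + 1 - 1) / (η * Real.log N ^ δ) :=
    div_nonneg (by positivity) (mul_pos hη hlNδ).le
  have hτ : ∀ T : Finset (Fin (s + 1)), T ≠ ∅ → |θ T| ≤ 8 ^ (s + 1 - 1) *
      (2 ^ (s + 1) * ((U : ℝ) ^ p)⁻¹ + 4 * (2 ^ (s + 1 - 1) * (U : ℝ) ^ (s + 1 - 1) / (η * Real.log N ^ δ))) := by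
    refine quantClip_thetaSmall hU16 θ hθ2 a ha0 ha1pos hasum (fun j => cellDensity j U) hI hI0 hI1 hIbal hlN
      hεa100 hanat (fun j => (jointCell (s + 1) N U Ψ K j : ℝ)) (fun j => Nat.cast_nonneg _) hMS0
      (by positivity) hlaw ?_ hϑpos hν₀0 (hu₀ U hUu₀) hr hν₁ hν₂ hsmall
    intro i w hw z hz
    exact hHN i w hw z ((fibreSum_cast _ _ i w z).symm.trans hz)
  have hθS : |θ S| ≤ 8 ^ s * (2 ^ (s + 1) + 1) * ((U : ℝ) ^ (m + 4 * (s + 1)))⁻¹ := by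
    have h := hτ S (nonempty_iff_ne_empty.mp hS)
    rw [Nat.add_sub_cancel] at h hν₁
    rw [← hp]
    calc |θ S| ≤ 8 ^ s * (2 ^ (s + 1) * ((U : ℝ) ^ p)⁻¹ + 4 * (2 ^ s * (U : ℝ) ^ s / (η * Real.log N ^ δ))) := h
      _ ≤ 8 ^ s * (2 ^ (s + 1) * ((U : ℝ) ^ p)⁻¹ + ((U : ℝ) ^ p)⁻¹) := by gcongr
      _ = 8 ^ s * (2 ^ (s + 1) + 1) * ((U : ℝ) ^ p)⁻¹ := by ring
  -- (2) WALSH INVERSION, reversed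
  have hX : |(siftedLiouvilleCorr (s + 1) N U Ψ K S : ℝ)| ≤ (U : ℝ) ^ (s + 1) * (N / (Real.log N ^ (s + 1) * Real.log N ^ δ)) +
      archFactor Ψ K * singularProduct Ψ * (|θ S| * (∑ n ∈ Icc 1 U, a n) ^ (s + 1) +
        2 ^ (s + 1 + 1) * |∑ n ∈ Icc 1 U, (-1 : ℝ) ^ n * a n| * (∑ n ∈ Icc 1 U, a n) ^ (s + 1 - 1)) := by
    rw [← MixedPoly.sum_sign_jointCell_eq_corr Ψ K hNnat hU1nat hΨL hz2 hzL S]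
    exact MixedPoly.abs_sum_sign_cells_le θ hθ2 _ hMS0.le a ha0 S hlaw
  rw [Nat.add_sub_cancel] at hX
  -- (3) SIZES
  have hll0 : 0 ≤ Real.log (Real.log N) := by
    apply Real.log_nonneg
    have : (1 : ℝ) ≤ Real.exp (4 * (U : ℝ) ^ 2) := Real.one_le_exp (by positivity)
    linarith
  rw [Nat.add_sub_cancel] at hMSle
  have hK₂U : K₂ ≤ U := le_trans (Nat.le_ceil _) (by exact_mod_cast hUK₂)
  have hK₃U : K₃ ≤ U := le_trans (Nat.le_ceil _) (by exact_mod_cast hUK₃)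
  rw [hK₂] at hK₂U
  rw [hK₃] at hK₃U
  rw [hp] at hAm
  exact MixedPoly.final_bound hU1nat hN0 hlN hC_g hMSle hll0 hll hAp0 hAp (abs_nonneg _) hAm (abs_nonneg _) hθS
    hDm hK₂U hK₃U hX

end Summit.Parity.GeneralizedHardyLittlewood.Cruxes.FibreHyperbolicityAlong.SiftedChowlaDistillation

end
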